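import Literature.Probability.Percolation.ZdFourArmSepGlueProb
import Literature.Probability.Percolation.ZdFourArmQuasiMultProofs
import Literature.Probability.Percolation.ZdEdgeFourArmQuasiMultReduction
import HarnessLib

/-!
# The alternating four-arm probability of `ℤ²` is bounded below at bounded ratio

Topic `Literature/Probability/Percolation`; bond percolation on `ℤ² = Site 2` at `p = 1/2`
(`bondPercolation (zdGraph 2) half`), four alternating arms in the cluster form
`fourArmTwoClusters m N` of `FourArmGarban.lean`. PROOFS ONLY (no definition, no named fact).

The normal form `zdFourArm_quasiMult_of_spaced` (`ZdFourArmQuasiMultProofs.lean`) of the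
quasi-multiplicativity fact `DuminilCopinManolescuTassion2021_zdFourArm_quasiMult`
(`ZdFourArmQuasiMult.lean`; DMT 2021, Prop. 6.3; Nolin 2008, Prop. 17 [arXiv 0711.4948: Prop. 16];
Kesten 1987) has two inputs: the well-spaced case (Kesten's arm separation and gluing) and the
**a-priori positivity of the four-arm probability at bounded ratio**,
`a ≤ P_{1/2}(𝒜₄(A_{m,N}))` for `m ≤ N ≤ B m` — Nolin 2008, Prop. 14 [arXiv Prop. 13], lower half, at
bounded ratio; in `ZdFourArmQuasiMultProofs.lean` that input is drawn from the (stronger, unproved)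
lower-bound fact `DuminilCopinManolescuTassion2021_zdFourArm_lowerBound`. This file PROVES it
directly from the box-crossing property (RSW), by the standard four-corridor construction:

* an open left–right crossing of `[m, N] × [0, h]` and one of `[-N, -m] × [0, h]` (`h + 1 ≤ m`) are
  two open crossings of `A_{m,N}` from `‖·‖_∞ = m` to `‖·‖_∞ = N` (their sites have `|x₀| ≥ m`);
* a closed-dual top–bottom crossing of the face column band `[0, h₁]` between the face rows
  `m - 1` and `N`, stopped at its first face of the row `m - 1` (`exists_faceWalk_exit_row_lt`,
  `ZdFourArmSepGlue.lean`), and its mirror image below, are two dual arms hanging from the inner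
  top and bottom sides to the levels `N`, `-N-1`, crossing closed edges off the hole `B(m-1)`;
  by the barrier lemma `not_openConnIn_sqAnnulus_of_dualArmsTB` (`SqAnnulusDualBarrier.lean`) the
  inner ends of the two open crossings are then not joined inside the annulus
  (`mem_fourArmTwoClusters_of_corridors`);
* the two open corridors form an increasing event, the two dual ones a decreasing event, read on
  disjoint sets of pairs (`|x₀| ≥ m` versus `0 ≤ x₀ ≤ h₁ + 1 < m`), so Harris's inequality
  (`le_real_inter_of_upper/lower`) and independence (`bondPercolation_real_inter_of_disjoint`)
  give `P ≥ c⁴` with `c` the RSW constant at aspect ratio `16 B + 16`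
  (`rsw_lowerBound_holds`, `le_real_lrCrossingAt_of_rsw_ratio`, `le_real_dualFaceCrossing_of_rsw_ratio`
  of `ZdFourArmSepGlueProb.lean`; heights `h + 1 = 2⌊m/4⌋`, `h₁ + 1 = ⌊m/4⌋`)
  (`exists_pos_le_real_fourArmTwoClusters_of_ratio`, threshold `m ≥ 8`; all `m ≥ 1` in
  `exists_pos_le_real_fourArmTwoClusters_of_ratio_one`, the finitely many small scales being
  positive by `exists_pos_le_real_fourArmTwoClusters_of_le`).

Consequences: the quasi-multiplicativity fact, and the single-bond quasi-multiplicativity fact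
`Nolin2008_zdEdgeFourArmQuasiMult` reduced to it in `ZdEdgeFourArmQuasiMultReduction.lean`,
follow from the WELL-SPACED case alone (`DuminilCopinManolescuTassion2021_zdFourArm_quasiMult_of_wellSpaced`,
`Nolin2008_zdEdgeFourArmQuasiMult_of_wellSpaced`): no five-arm / four-arm lower bound is needed —
only Kesten's arm-separation theorem for bond percolation on `ℤ²`, through the gluing inequality
`real_fourArmTwoClusters_ge_of_sep` (`ZdFourArmSepGlueProb.lean`).

## References

* P. Nolin, *Near-critical percolation in two dimensions*, EJP 13 (2008), §4.1 and §4.3 Prop. 14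
  (lower bound) [arXiv 0711.4948: Prop. 13]; §4.5 Prop. 17, proof, first sentence [arXiv Prop. 16]
  [Nolin2008].
* H. Kesten, *Scaling relations for 2D-percolation*, Comm. Math. Phys. 109 (1987), §2
  [KestenScalingCMP1987].
* B. Bollobás, O. Riordan, *Percolation* (2006), Ch. 3, Lemma 1, Cor. 3, Cor. 6 (RSW on `ℤ²`)
  [BollobasRiordan2006].
* H. Duminil-Copin, I. Manolescu, V. Tassion, PTRF 181 (2021), §6.2 Prop. 6.3
  [DuminilCopinManolescuTassion2021].

Tree: `lrCrossingAt`, `exists_walk_of_mem_lrCrossingAt`, `bondPercolation_real_lrCrossingAt`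
(`CrossingChains.lean`); `dualFaceCrossing`, `dualFaceCrossingPairs`, `determinedBy_dualFaceCrossing`,
`crossingProb_le_real_dualFaceCrossing`, `apply_le_of_mem_rectanglePairs`,
`apply_le_of_mem_dualFaceCrossingPairs`, `le_real_inter_of_upper`, `le_real_inter_of_lower`
(`ZdFiveArmPointBoundOfSeparation.lean`); `exists_faceWalk_exit_row_lt/ge`, `faceWalk_reverse`,
`openWalk_reverse`, `mem_sqAnnulus_of_corridorR/L`, `notMem_box_of_lt_apply`, `notMem_box_of_apply_lt`,
`forall_darts_reverse_sepEdge_notMem` (`ZdFourArmSepGlue.lean`); `le_real_lrCrossingAt_of_rsw_ratio`,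
`le_real_dualFaceCrossing_of_rsw_ratio` (`ZdFourArmSepGlueProb.lean`); `not_openConnIn_sqAnnulus_of_dualArmsTB`
(`SqAnnulusDualBarrier.lean`); `mem_siteSphere_of_apply_zero` (`ZdFiveArmSeparated.lean`);
`rsw_lowerBound_holds` (`RSWLemma.lean`), `crossingProb_anti_left` (`RSW.lean`);
`determinedBy_openCrossing_image` (`HarrisTheorem.lean`); `bondPercolation_real_inter_of_disjoint`
(`FiniteEnergy.lean`); `zdFourArm_quasiMult_of_spaced`, `exists_pos_le_real_fourArmTwoClusters_of_le`
(`ZdFourArmQuasiMultProofs.lean`); `Nolin2008_zdEdgeFourArmQuasiMult_of_zdFourArm_quasiMult`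
(`ZdEdgeFourArmQuasiMultReduction.lean`).
-/

noncomputable section

open MeasureTheory Set

namespace Literature.Probability.Percolation

open LatticeModels SimpleGraph

/-! ### Four corridor crossings give four arms -/

/-- **Four corridor crossings give the four-arm event** (the bounded-ratio construction of
Nolin 2008, §4.1 / Prop. 14, lower half, in the cluster form of the tree). On a lattice
configuration, an open left–right crossing of `[r, R] × [0, h]`, an open left–right crossing of
`[-R, -r] × [0, h]` (`h + 1 ≤ r`), a closed-dual top–bottom crossing of the faces of columns
`[0, h₁]` between the rows `r - 1` and `R` and one between the rows `-R - 1` and `-r`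
(`h₁ + 2 ≤ r`) force `fourArmTwoClusters r R`: the open crossings lie in `A_{r,R}` with endpoints
on `‖·‖_∞ = r`, `‖·‖_∞ = R`, and the dual crossings, stopped at their first face of the rows
`r - 1`, resp. `-r` (`exists_faceWalk_exit_row_lt/ge`), are dual arms hanging from the inner top
and bottom sides crossing closed edges off `B(r-1)`, which separate the two inner ends inside the
annulus (`not_openConnIn_sqAnnulus_of_dualArmsTB`). [cite: Nolin2008, §4.1 and Prop. 14, lower bound (arXiv 0711.4948: Prop. 13)] -/
theorem mem_fourArmTwoClusters_of_corridors {ω : BondConfig (Site 2)} (hω : ω ⊆ (zdGraph 2).edgeSet)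
    {r R M h h₁ : ℕ} (hr : 2 ≤ r) (hM : r + M = R) (hh : h + 1 ≤ r) (hh₁ : h₁ + 2 ≤ r)
    (hTR : ω ∈ lrCrossingAt ![(r : ℤ), 0] M h) (hTL : ω ∈ lrCrossingAt ![-(R : ℤ), 0] M h)
    (hDT : ω ∈ dualFaceCrossing ![0, (r : ℤ)] (h₁ + 1) M)
    (hDB : ω ∈ dualFaceCrossing ![0, -(R : ℤ)] (h₁ + 1) M) :
    ω ∈ fourArmTwoClusters r R := by
  have hr1 : 1 ≤ r := by omega
  have hR1 : 1 ≤ R := by omega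
  have hrR : r ≤ R := by omega
  -- RIGHT open crossing: a walk of `[r, R] × [0, h]` from the column `r` to the column `R`
  obtain ⟨e, y, T, he0, hy0, hTs, hTo⟩ := exists_walk_of_mem_lrCrossingAt hω hTR
  simp only [Matrix.cons_val_zero, Matrix.cons_val_one] at he0 hy0 hTs
  have okT : ∀ z ∈ T.support, z ∈ sqAnnulus r R := fun z hz =>
    mem_sqAnnulus_of_corridorR hr1 (a := (r : ℤ)) (b := (r : ℤ) + M) (h := (h : ℤ)) le_rfl
      (by omega) (by omega) (by have := hTs z hz; omega)
  have connR : ω ∈ openConnIn (sqAnnulus r R) e y := mem_openConnIn_of_walk T okT hTo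
  -- LEFT open crossing: a walk of `[-R, -r] × [0, h]` from the column `-R` to the column `-r`
  obtain ⟨x, w, T', hx0, hw0, hT's, hT'o⟩ := exists_walk_of_mem_lrCrossingAt hω hTL
  simp only [Matrix.cons_val_zero, Matrix.cons_val_one] at hx0 hw0 hT's
  have okT' : ∀ z ∈ T'.support, z ∈ sqAnnulus r R := fun z hz =>
    mem_sqAnnulus_of_corridorL hr1 (a := -(R : ℤ)) (b := -(R : ℤ) + M) (h := (h : ℤ)) le_rfl
      (by omega) (by omega) (by have := hT's z hz; omega)
  have hrev := openWalk_reverse T' ⟨okT', hT'o⟩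
  have connL : ω ∈ openConnIn (sqAnnulus r R) w x := mem_openConnIn_of_walk T'.reverse hrev.1 hrev.2
  -- TOP dual arm: stop the dual crossing at its first face of the row `r - 1`, then reverse it
  obtain ⟨aT, bT, W₀, haT, hbT, hW₀s, hW₀c⟩ := hDT
  simp only [Matrix.cons_val_zero, Matrix.cons_val_one] at haT hbT hW₀s
  obtain ⟨c₁, V₀, hc₁1, -, ⟨xT, hxT, hxT0, -⟩, -, hV₀c, hV₀off⟩ :=
    exists_faceWalk_exit_row_lt W₀ hW₀c r (by omega) (by omega)
  have hc₁0 : 0 ≤ c₁ 0 ∧ c₁ 0 ≤ h₁ := by have := hW₀s xT hxT; omega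
  have hδ₁ : ∀ d ∈ V₀.reverse.darts, sepEdge d.fst d.snd ∉ ω ∧
      ∀ v ∈ sepEdge d.fst d.snd, v ∉ box 2 (r - 1) :=
    faceWalk_reverse V₀ fun d hd =>
      ⟨hV₀c d hd, fun v hv => notMem_box_of_lt_apply 1 (by have := hV₀off d hd v hv; omega)⟩
  -- BOTTOM dual arm: the same from below
  obtain ⟨aB, bB, X₀, haB, hbB, hX₀s, hX₀c⟩ := hDB
  simp only [Matrix.cons_val_zero, Matrix.cons_val_one] at haB hbB hX₀s
  obtain ⟨c₂, V₀', hc₂1, -, ⟨xB, hxB, hxB0, -⟩, -, hV₀'c, hV₀'off⟩ :=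
    exists_faceWalk_exit_row_ge X₀.reverse (forall_darts_reverse_sepEdge_notMem X₀ hX₀c) r
      (by omega) (by omega)
  have hc₂0 : 0 ≤ c₂ 0 ∧ c₂ 0 ≤ h₁ := by
    rw [Walk.support_reverse, List.mem_reverse] at hxB
    have := hX₀s xB hxB; omega
  have hδ₂ : ∀ d ∈ V₀'.reverse.darts, sepEdge d.fst d.snd ∉ ω ∧
      ∀ v ∈ sepEdge d.fst d.snd, v ∉ box 2 (r - 1) :=
    faceWalk_reverse V₀' fun d hd =>
      ⟨hV₀'c d hd, fun v hv => notMem_box_of_apply_lt 1 (by have := hV₀'off d hd v hv; omega)⟩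
  -- assembly
  have he1 : 0 ≤ e 1 ∧ e 1 ≤ h := by have := hTs e T.start_mem_support; omega
  have hy1 : 0 ≤ y 1 ∧ y 1 ≤ h := by have := hTs y T.end_mem_support; omega
  have hx1 : 0 ≤ x 1 ∧ x 1 ≤ h := by have := hT's x T'.start_mem_support; omega
  have hw1 : 0 ≤ w 1 ∧ w 1 ≤ h := by have := hT's w T'.end_mem_support; omega
  have hw0' : w 0 = -(r : ℤ) := by omega
  have hy0' : y 0 = (R : ℤ) := by omega
  have hsep : ω ∉ openConnIn (sqAnnulus r R) e w :=
    not_openConnIn_sqAnnulus_of_dualArmsTB hr hrR hω he0 (abs_le.2 ⟨by omega, by omega⟩)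
      hw0' (abs_le.2 ⟨by omega, by omega⟩)
      V₀.reverse ⟨by omega, by omega, by omega⟩ (by omega) hδ₁
      V₀'.reverse ⟨by omega, by omega, by omega⟩ (by omega) hδ₂
  exact ⟨e, mem_siteSphere_of_apply_zero hr1 (Or.inl he0) (abs_le.2 ⟨by omega, by omega⟩),
    w, mem_siteSphere_of_apply_zero hr1 (Or.inr hw0') (abs_le.2 ⟨by omega, by omega⟩),
    y, mem_siteSphere_of_apply_zero hR1 (Or.inl hy0') (abs_le.2 ⟨by omega, by omega⟩),
    x, mem_siteSphere_of_apply_zero hR1 (Or.inr hx0) (abs_le.2 ⟨by omega, by omega⟩),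
    connR, connL, hsep⟩

/-! ### Positivity at bounded ratio -/

/-- **The four-arm probability is bounded below at bounded ratio** (Nolin 2008, Prop. 14
[arXiv 0711.4948: Prop. 13], lower bound, at bounded ratio, for bond percolation on `ℤ²`, §8.1):
for every `B` there is `a > 0` with `a ≤ P_{1/2}(𝒜₄(A_{m,N}))` whenever `8 ≤ m ≤ N ≤ B m`. Proof:
RSW at aspect ratio `16 B + 16` for the four corridors of `mem_fourArmTwoClusters_of_corridors`
(heights `2⌊m/4⌋` and `⌊m/4⌋`), Harris for the two open and for the two dual corridors, and
independence of the increasing and decreasing parts, which read disjoint sets of pairs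
(`|x₀| ≥ m` versus `0 ≤ x₀ ≤ ⌊m/4⌋`); `a = c⁴`. [cite: Nolin2008, §4.3 Prop. 14, lower bound (arXiv 0711.4948: Prop. 13); §8.1 (square lattice, bond percolation)] -/
theorem exists_pos_le_real_fourArmTwoClusters_of_ratio (B : ℕ) :
    ∃ a : ℝ, 0 < a ∧ ∀ m N : ℕ, 8 ≤ m → m ≤ N → N ≤ B * m →
      a ≤ (bondPercolation (zdGraph 2) half).real (fourArmTwoClusters m N) := by
  obtain ⟨c, hc0, hc⟩ := rsw_lowerBound_holds (16 * B + 16) (by omega)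
  refine ⟨c * c * (c * c), by positivity, fun m N hm hmN hNB => ?_⟩
  set μ := bondPercolation (zdGraph 2) half with hμ
  -- scales
  set q : ℕ := m / 4 with hq
  have hq1 : 2 ≤ q := by omega
  have hqm : 4 * q ≤ m ∧ m ≤ 4 * q + 3 := by omega
  set M : ℕ := N - m with hMdef
  have hM : m + M = N := by omega
  -- aspect ratios
  have hBq : B ≤ B * q := Nat.le_mul_of_pos_right B (by omega)
  have hNB' : N ≤ 4 * (B * q) + 3 * B := by
    have h1 : N ≤ B * (4 * q + 3) := hNB.trans (Nat.mul_le_mul_left B hqm.2)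
    have h2 : B * (4 * q + 3) = 4 * (B * q) + 3 * B := by ring
    omega
  have hasp₁ : M ≤ (16 * B + 16) * (2 * q - 1 + 1) - 1 := by
    have h1 : (16 * B + 16) * (2 * q - 1 + 1) = 32 * (B * q) + 32 * q := by
      rw [show 2 * q - 1 + 1 = 2 * q by omega]; ring
    rw [h1]; omega
  have hasp₂ : M + 1 ≤ (16 * B + 16) * (q - 1 + 1) - 1 := by
    have h1 : (16 * B + 16) * (q - 1 + 1) = 16 * (B * q) + 16 * q := by
      rw [show q - 1 + 1 = q by omega]; ring
    rw [h1]; omega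
  -- the four corridor events and their probabilities
  set UR := lrCrossingAt ![(m : ℤ), 0] M (2 * q - 1) with hUR
  set UL := lrCrossingAt ![-(N : ℤ), 0] M (2 * q - 1) with hUL
  set DT := dualFaceCrossing ![0, (m : ℤ)] (q - 1 + 1) M with hDT
  set DB := dualFaceCrossing ![0, -(N : ℤ)] (q - 1 + 1) M with hDB
  have hUR' : c ≤ μ.real UR := le_real_lrCrossingAt_of_rsw_ratio hc _ hasp₁
  have hUL' : c ≤ μ.real UL := le_real_lrCrossingAt_of_rsw_ratio hc _ hasp₁
  have hDT' : c ≤ μ.real DT := le_real_dualFaceCrossing_of_rsw_ratio hc _ hasp₂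
  have hDB' : c ≤ μ.real DB := le_real_dualFaceCrossing_of_rsw_ratio hc _ hasp₂
  have hU : c * c ≤ μ.real (UR ∩ UL) :=
    le_real_inter_of_upper hc0.le hc0.le (isUpperSet_lrCrossingAt _ _ _) (isUpperSet_lrCrossingAt _ _ _)
      (measurableSet_lrCrossingAt _ _ _) (measurableSet_lrCrossingAt _ _ _) hUR' hUL'
  have hD : c * c ≤ μ.real (DT ∩ DB) :=
    le_real_inter_of_lower hc0.le hc0.le (isLowerSet_dualFaceCrossing _ _ _) (isLowerSet_dualFaceCrossing _ _ _)
      (measurableSet_dualFaceCrossing _ _ _) (measurableSet_dualFaceCrossing _ _ _) hDT' hDB'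
  -- locality: the open corridors read pairs with `|x₀| ≥ m`, the dual ones pairs with `0 ≤ x₀ ≤ q`
  set FU : Finset (Sym2 (Site 2)) :=
    ((rectangle M (2 * q - 1)).image (· + (![(m : ℤ), 0] : Site 2))).sym2 ∪
      ((rectangle M (2 * q - 1)).image (· + (![-(N : ℤ), 0] : Site 2))).sym2 with hFU
  set FD : Finset (Sym2 (Site 2)) :=
    dualFaceCrossingPairs ![0, (m : ℤ)] (q - 1 + 1) M ∪
      dualFaceCrossingPairs ![0, -(N : ℤ)] (q - 1 + 1) M with hFD
  have dU : DeterminedBy (UR ∩ UL) ↑FU := by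
    rw [hFU, Finset.coe_union]
    exact ((determinedBy_openCrossing_image _ _ _ _).mono Set.subset_union_left).inter
      ((determinedBy_openCrossing_image _ _ _ _).mono Set.subset_union_right)
  have dD : DeterminedBy (DT ∩ DB) ↑FD := by
    rw [hFD, Finset.coe_union]
    exact ((determinedBy_dualFaceCrossing _ _ _).mono Set.subset_union_left).inter
      ((determinedBy_dualFaceCrossing _ _ _).mono Set.subset_union_right)
  have hdisj : Disjoint (↑FU : Set (Sym2 (Site 2))) ↑FD := by
    rw [Finset.disjoint_coe, Finset.disjoint_left]
    intro e heU heD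
    obtain ⟨z, hz⟩ : ∃ z, z ∈ e := ⟨e.out.1, Sym2.out_fst_mem e⟩
    have hzD : 0 ≤ z 0 ∧ z 0 ≤ q := by
      rw [hFD, Finset.mem_union] at heD
      rcases heD with h' | h'
      · have := apply_le_of_mem_dualFaceCrossingPairs h' hz
        simp only [Matrix.cons_val_zero, Matrix.cons_val_one] at this
        omega
      · have := apply_le_of_mem_dualFaceCrossingPairs h' hz
        simp only [Matrix.cons_val_zero, Matrix.cons_val_one] at this
        omega
    rw [hFU, Finset.mem_union] at heU
    rcases heU with h' | h'
    · have := apply_le_of_mem_rectanglePairs h' hz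
      simp only [Matrix.cons_val_zero, Matrix.cons_val_one] at this
      omega
    · have := apply_le_of_mem_rectanglePairs h' hz
      simp only [Matrix.cons_val_zero, Matrix.cons_val_one] at this
      omega
  have hmU : MeasurableSet (UR ∩ UL) :=
    (measurableSet_lrCrossingAt _ _ _).inter (measurableSet_lrCrossingAt _ _ _)
  have hmD : MeasurableSet (DT ∩ DB) :=
    (measurableSet_dualFaceCrossing _ _ _).inter (measurableSet_dualFaceCrossing _ _ _)
  have hind := bondPercolation_real_inter_of_disjoint (zdGraph 2) half hdisj dU dD hmU hmD
  -- the corridors give four arms (on lattice configurations)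
  have hae : ∀ᵐ ω ∂μ, ω ⊆ (zdGraph 2).edgeSet := ProbabilityTheory.setBernoulli_ae_subset
  have hsub : ∀ᵐ ω ∂μ, ω ∈ UR ∩ UL ∩ (DT ∩ DB) → ω ∈ fourArmTwoClusters m N := by
    filter_upwards [hae] with ω hω h'
    exact mem_fourArmTwoClusters_of_corridors hω (by omega) hM (by omega) (by omega)
      h'.1.1 h'.1.2 h'.2.1 h'.2.2
  calc c * c * (c * c) ≤ μ.real (UR ∩ UL) * μ.real (DT ∩ DB) :=
        mul_le_mul hU hD (by positivity) measureReal_nonneg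
    _ = μ.real (UR ∩ UL ∩ (DT ∩ DB)) := hind.symm
    _ ≤ μ.real (fourArmTwoClusters m N) :=
        ENNReal.toReal_mono (measure_ne_top _ _) (measure_mono_ae hsub)

/-- **Bounded-ratio positivity for all inner radii `m ≥ 1`**: for every `B` there is `a > 0`
with `a ≤ P_{1/2}(𝒜₄(A_{m,N}))` whenever `1 ≤ m ≤ N ≤ B m` (the scales `m < 8` are finitely many,
`exists_pos_le_real_fourArmTwoClusters_of_le`). Nolin 2008, §4.1: "for any fixed `n₁, n₂ ≥ n₀(j)`,
`P̂(A_{j,σ}(n₁,N)) ≍ P̂(A_{j,σ}(n₂,N))`", `n₀(4) = 0`. [cite: Nolin2008, §4.3 Prop. 14, lower bound (arXiv 0711.4948: Prop. 13); §8.1] -/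
theorem exists_pos_le_real_fourArmTwoClusters_of_ratio_one (B : ℕ) :
    ∃ a : ℝ, 0 < a ∧ ∀ m N : ℕ, 1 ≤ m → m ≤ N → N ≤ B * m →
      a ≤ (bondPercolation (zdGraph 2) half).real (fourArmTwoClusters m N) := by
  obtain ⟨a, ha, h⟩ := exists_pos_le_real_fourArmTwoClusters_of_ratio B
  obtain ⟨a', ha', h'⟩ := exists_pos_le_real_fourArmTwoClusters_of_le (B * 8)
  refine ⟨min a a', lt_min ha ha', fun m N hm hmN hNB => ?_⟩
  rcases le_or_gt 8 m with h8 | h8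
  · exact (min_le_left _ _).trans (h m N h8 hmN hNB)
  · exact (min_le_right _ _).trans (h' m N hm hmN (hNB.trans (Nat.mul_le_mul_left B h8.le)))

/-! ### Quasi-multiplicativity from the well-spaced case alone -/

/-- **`DuminilCopinManolescuTassion2021_zdFourArm_quasiMult` from its well-spaced case alone.**
If for one ratio `A ≥ 2` there is `c > 0` with
`c · P(𝒜₄(A_{r,ρ})) P(𝒜₄(A_{ρ,R})) ≤ P(𝒜₄(A_{r,R}))` whenever `1 ≤ r`, `A r ≤ ρ`, `A ρ ≤ R`
(Kesten's arm separation at the two sides of `∂Λ_ρ` and gluing), then the named fact holds: the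
normal form `zdFourArm_quasiMult_of_spaced` with its bounded-ratio input PROVED
(`exists_pos_le_real_fourArmTwoClusters_of_ratio`). [cite: Nolin2008, §4.5 Prop. 17, proof, first sentence (arXiv 0711.4948: Prop. 16)] [cite: DuminilCopinManolescuTassion2021, §6.2 Prop. 6.3, proof] -/
theorem DuminilCopinManolescuTassion2021_zdFourArm_quasiMult_of_wellSpaced {A : ℕ} (hA : 2 ≤ A)
    (hsp : ∃ c : ℝ, 0 < c ∧ ∀ r ρ R : ℕ, 1 ≤ r → A * r ≤ ρ → A * ρ ≤ R →
      c * ((bondPercolation (zdGraph 2) half).real (fourArmTwoClusters r ρ) *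
          (bondPercolation (zdGraph 2) half).real (fourArmTwoClusters ρ R)) ≤
        (bondPercolation (zdGraph 2) half).real (fourArmTwoClusters r R)) :
    DuminilCopinManolescuTassion2021_zdFourArm_quasiMult := by
  obtain ⟨a, ha, h⟩ := exists_pos_le_real_fourArmTwoClusters_of_ratio (A * A)
  exact zdFourArm_quasiMult_of_spaced hA
    ⟨a, ha, 8, fun m N hm hmN hN => h m N hm hmN (by rw [Nat.mul_assoc]; exact hN)⟩ hsp

/-- **`Nolin2008_zdEdgeFourArmQuasiMult` from the well-spaced quasi-multiplicativity of annuli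
alone** (`Nolin2008_zdEdgeFourArmQuasiMult_of_zdFourArm_quasiMult` composed with the previous
theorem). [cite: Nolin2008, §4.1 and §4.5 Prop. 17 (arXiv 0711.4948: Prop. 16)] -/
theorem Nolin2008_zdEdgeFourArmQuasiMult_of_wellSpaced {A : ℕ} (hA : 2 ≤ A)
    (hsp : ∃ c : ℝ, 0 < c ∧ ∀ r ρ R : ℕ, 1 ≤ r → A * r ≤ ρ → A * ρ ≤ R →
      c * ((bondPercolation (zdGraph 2) half).real (fourArmTwoClusters r ρ) *
          (bondPercolation (zdGraph 2) half).real (fourArmTwoClusters ρ R)) ≤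
        (bondPercolation (zdGraph 2) half).real (fourArmTwoClusters r R)) :
    Nolin2008_zdEdgeFourArmQuasiMult :=
  Nolin2008_zdEdgeFourArmQuasiMult_of_zdFourArm_quasiMult
    (DuminilCopinManolescuTassion2021_zdFourArm_quasiMult_of_wellSpaced hA hsp)

end Literature.Probability.Percolation

end
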